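import Mathlib
import Literature.MathematicalPhysics.StatisticalMechanics.HaggStacking
import Summits.AtomisticToContinuum.Crystallization.Theorems.PricedLinkCensusStackingHingeHaggDominationAllRanges

/-!
# Route PricedLinkCensus — Hägg domination WITH THE RATE (`StackingHinge`, line Sketch)
(stub `stub_haggDominationRate` of line Sketch, stmt-AtomisticToContinuum-14993)

The Peierls count behind Hägg domination (item stmt-AtomisticToContinuum-0737, landed as
`PricedHcpWindowsHaggDomination.stub_haggDominationAllRanges`) actually proves a RATE: for every
coupling `J : ℕ → ℝ` with `Σ k|J_k| < ∞`, every `±1` sequence `s` and every `n`,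

  `n · Σ_{k ≥ 2 even} J_k + b · (−J₂ − Σ_{k ≥ 3} (k−1)|J_k|) ≤ H_n(J, s) + Σ_k k|J_k|`,

where `b = #{m < n : s (m+1) = s m}` is the number of bad bonds (cubic layers) in `[0, n)` and
`H_n(J, s) = haggEnergy n J s = Σ_{m<n} Σ'_{k ≥ 2} J_k · 1[s_m + ⋯ + s_{m+k-1} ≡ 0 (mod 3)]`.
No domination hypothesis is needed; under `J₂ + Σ_{k≥3}(k−1)|J_k| ≤ 0` the `b`-term is
non-negative and dropping it gives item 0737 back.

Proof.  The termwise inequality `key` of the landed file gives, for every `k`,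
`n · J_k [2 ≤ k even] ≤ Σ_{m<n} J_k 1[window (m,k) aligned] + X_k` with `X_2 = J₂ b` and
`X_k = (b+1)(k−1)|J_k|` for `k ≥ 3`.  All series are dominated by `Σ k|J_k|`, so summing over `k`
and exchanging `Σ_{m<n}` with `Σ'_k` gives
`n Σ_{even} J_k ≤ H_n + J₂ b + (b + 1) E`, `E := Σ_{k≥3}(k−1)|J_k| ≤ Σ_k k|J_k|`, i.e.
`n Σ_{even} J_k + b(−J₂ − E) ≤ H_n + E ≤ H_n + Σ_k k|J_k|` (`assembleRate`).  Finally
`haggEnergy n J s` is definitionally the double sum (`stub_haggDominationRate`).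

All `[folklore]`.
-/

namespace Summit.AtomisticToContinuum.Crystallization.Theorems.PricedHcpWindowsHaggRate

open Finset Summit.AtomisticToContinuum.Crystallization.Theorems.PricedHcpWindowsHaggDomination

/-- The domination inequality with the bad-bond rate kept, the three series named (`g`: the even
couplings, `e`: the domination weights `(k−1)|J_k|`, `f m`: the column of `H_n` at layer `m`) and
`b` the number of bad bonds in `[0, n)`:
`n Σ' g + b (−J₂ − Σ' e) ≤ Σ_{m<n} Σ' f m + Σ' k|J_k|`. [folklore] -/
theorem assembleRate (J : ℕ → ℝ) (s : ℤ → ℤ) (n : ℕ) (hs : ∀ i, s i = 1 ∨ s i = -1)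
    (hsum : Summable (fun k : ℕ => (k : ℝ) * |J k|))
    (g : ℕ → ℝ) (hg : g = fun k : ℕ => if 2 ≤ k ∧ Even k then J k else 0)
    (e : ℕ → ℝ) (he : e = fun k : ℕ => if 3 ≤ k then ((k : ℝ) - 1) * |J k| else 0)
    (f : ℕ → ℕ → ℝ)
    (hf : f = fun (m : ℕ) (k : ℕ) =>
      if 2 ≤ k ∧ (∑ i ∈ range k, s ((m : ℤ) + i)) % 3 = 0 then J k else 0)
    (b : ℕ) (hb : b = ((range n).filter (fun m : ℕ => s ((m : ℤ) + 1) = s m)).card) :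
    (n : ℝ) * ∑' k, g k + (b : ℝ) * (-J 2 - ∑' k, e k) ≤
      (∑ m ∈ range n, ∑' k, f m k) + ∑' k : ℕ, (k : ℝ) * |J k| := by
  obtain ⟨X, hX⟩ : ∃ X : ℕ → ℝ,
      X = fun k : ℕ => (if k = 2 then J 2 * (b : ℝ) else 0) + ((b : ℝ) + 1) * e k := ⟨_, rfl⟩
  -- one `|J k|` is dominated by `k |J k|` as soon as the guard `2 ≤ k` holds
  have hJle : ∀ k : ℕ, 2 ≤ k → |J k| ≤ (k : ℝ) * |J k| := fun k hk =>
    le_mul_of_one_le_left (abs_nonneg _) (by exact_mod_cast (show 1 ≤ k by omega))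
  have hg_sum : Summable g := by
    refine Summable.of_norm_bounded hsum (fun k => ?_)
    simp only [hg, Real.norm_eq_abs]
    split_ifs with h
    · exact hJle k h.1
    · rw [abs_zero]; positivity
  have hf_sum : ∀ m : ℕ, Summable (f m) := by
    intro m
    refine Summable.of_norm_bounded hsum (fun k => ?_)
    simp only [hf, Real.norm_eq_abs]
    split_ifs with h
    · exact hJle k h.1
    · rw [abs_zero]; positivity
  have he_le : ∀ k, e k ≤ (k : ℝ) * |J k| := by
    intro k
    simp only [he]
    split_ifs with h
    · nlinarith [abs_nonneg (J k)]
    · positivity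
  have he_nonneg : ∀ k, 0 ≤ e k := by
    intro k
    simp only [he]
    split_ifs with h
    · have : (1 : ℝ) ≤ k := by exact_mod_cast (show 1 ≤ k by omega)
      nlinarith [abs_nonneg (J k)]
    · exact le_rfl
  have he_sum : Summable e := Summable.of_nonneg_of_le he_nonneg he_le hsum
  have hind_sum : Summable (fun k : ℕ => if k = 2 then J 2 * (b : ℝ) else 0) :=
    (hasSum_ite_eq 2 (J 2 * (b : ℝ))).summable
  have hX_sum : Summable X := by rw [hX]; exact hind_sum.add (he_sum.mul_left _)
  have hF_sum : Summable (fun k => ∑ m ∈ range n, f m k) := summable_sum (fun m _ => hf_sum m)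
  -- termwise Peierls inequality
  have key' : ∀ k, (n : ℝ) * g k ≤ (∑ m ∈ range n, f m k) + X k := by
    intro k
    have h := key hs J n k
    rw [← hb] at h
    rw [hg, hf, hX, he]
    exact h
  -- summing over `k`
  have h0 : (n : ℝ) * ∑' k, g k = ∑' k, (n : ℝ) * g k := tsum_mul_left.symm
  have h1 : ∑' k, (n : ℝ) * g k ≤ ∑' k, ((∑ m ∈ range n, f m k) + X k) :=
    Summable.tsum_le_tsum key' (hg_sum.mul_left _) (hF_sum.add hX_sum)
  have h2 : ∑' k, ((∑ m ∈ range n, f m k) + X k) =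
      (∑ m ∈ range n, ∑' k, f m k) + ∑' k, X k := by
    rw [Summable.tsum_add hF_sum hX_sum, Summable.tsum_finsetSum (fun m _ => hf_sum m)]
  have h3 : ∑' k, X k = J 2 * (b : ℝ) + ((b : ℝ) + 1) * ∑' k, e k := by
    rw [hX]
    rw [Summable.tsum_add hind_sum (he_sum.mul_left _), tsum_ite_eq, tsum_mul_left]
  have h4 : ∑' k, e k ≤ ∑' k : ℕ, (k : ℝ) * |J k| := Summable.tsum_le_tsum he_le he_sum hsum
  -- bookkeeping: `n Σ' g + b (−J₂ − E) ≤ H_n + J₂ b + (b+1) E − b J₂ − b E = H_n + E ≤ H_n + Σ k|J_k|`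
  have h5 : (b : ℝ) * (-J 2 - ∑' k, e k) = -(J 2 * (b : ℝ) + ((b : ℝ) + 1) * ∑' k, e k) +
      ∑' k, e k := by ring
  rw [h0, h5]
  linarith [h1, h2, h3, h4]

/-- **Hägg domination with the rate** (line Sketch of `PricedLinkCensus.StackingHinge`): for `J`
with `Σ k|J_k| < ∞`, every `±1` sequence `s` and every `n`,
`n · Σ_{k ≥ 2 even} J_k + b · (−J₂ − Σ_{k≥3}(k−1)|J_k|) ≤ H_n(J, s) + Σ_k k|J_k|`,
`b = #{m < n : s (m+1) = s m}` the number of bad bonds — the Peierls count of item 0737 with its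
rate kept and NO domination hypothesis. [folklore] -/
theorem stub_haggDominationRate : ∀ (J : ℕ → ℝ) (s : ℤ → ℤ) (n : ℕ), (∀ i : ℤ, s i = 1 ∨ s i = -1) → Summable (fun k : ℕ => (k : ℝ) * |J k|) → (n : ℝ) * (∑' k : ℕ, (if 2 ≤ k ∧ Even k then J k else 0)) + (((Finset.range n).filter (fun m : ℕ => s ((m : ℤ) + 1) = s m)).card : ℝ) * (-J 2 - ∑' k : ℕ, (if 3 ≤ k then ((k : ℝ) - 1) * |J k| else 0)) ≤ Literature.MathematicalPhysics.StatisticalMechanics.haggEnergy n J s + ∑' k : ℕ, (k : ℝ) * |J k| := by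
  intro J s n hs hsum
  have hE : Literature.MathematicalPhysics.StatisticalMechanics.haggEnergy n J s =
      ∑ m ∈ range n, ∑' k : ℕ,
        (if 2 ≤ k ∧ (∑ i ∈ range k, s ((m : ℤ) + i)) % 3 = 0 then J k else 0) := rfl
  rw [hE]
  exact assembleRate J s n hs hsum _ rfl _ rfl _ rfl _ rfl

end Summit.AtomisticToContinuum.Crystallization.Theorems.PricedHcpWindowsHaggRate
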